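import Summits.KontsevichZagierPeriods.KontsevichZagierPeriods.Theses.IsogenyCertificates
import Summits.KontsevichZagierPeriods.KontsevichZagierPeriods.Theorems.XMapPeriodTransfer.Negative.LoadBearingDatum
import Summits.KontsevichZagierPeriods.KontsevichZagierPeriods.Theorems.XMapPeriodTransfer.Negative.ValueEqLoadBearing
import Summits.KontsevichZagierPeriods.KontsevichZagierPeriods.Theorems.IsogenyCertificatesXMapPeriodTransferCellsBasic
import Summits.KontsevichZagierPeriods.KontsevichZagierPeriods.Theorems.IsogenyCertificatesXMapPeriodTransferStubCellMove
import Summits.KontsevichZagierPeriods.KontsevichZagierPeriods.Theorems.IsogenyCertificatesXMapPeriodTransferStubCellCensus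
import Summits.KontsevichZagierPeriods.KontsevichZagierPeriods.Theorems.IsogenyCertificatesXMapPeriodTransferStubDupDatum
import Summits.KontsevichZagierPeriods.KontsevichZagierPeriods.Theorems.IsogenyCertificatesXMapPeriodTransferCellImage
import Literature.NumberTheory.Transcendental.KZLogCalculusProofs

/-!
# `XMapPeriodTransfer` (stmt-KontsevichZagierPeriods-10665) — line `saturated-sign-cells`

Proof of the crux `IsogenyCertificates.XMapPeriodTransfer` (route IsogenyCertificates, rank 3) by the
line `saturated-sign-cells` (Cruxes/XMapPeriodTransfer/PICKED.md, Lines/saturated_sign_cells.lean):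
WLOG `f, g` coprime (`XMapPeriodTransferDatum.iff_coprime`); the cells of `{P > 0} ∖ {W = 0}` are
mapped by `R = f/g` strictly monotonically (`stub_cellMonotone`) onto WHOLE components of `{P' > 0}`
(`stub_cellEnds`, `stub_intervalImage`, `stub_cubicComponents`); one rule-(2) move per cell
(`stub_cellMove`) and finite domain/integrand additivity give the census
`[K, a/√P] ≡ [U', (m_U a/|c|)/√P'] + [egg', (m_E a/|c|)/√P']` (`stub_cellCensus`); the duplication
datum on the target (`stub_dupDatum`, all cells onto `U'` by the 2-descent square identity) pushes
both `[r]` and `[r']` onto `[U', γ/√P']`, `[U', γ'/√P']` with rational `γ, γ'`; soundness,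
`r.value = r'.value` (used exactly once, here) and `∫_{U'} dx/√P' > 0` give `γ = γ'`. No definitions
are introduced (the x-map, Wronskian, cell locus, unbounded component and egg are written out).
`XMapPeriodTransfer_of` concludes the route declaration by name; this file only composes the eight
landed stub files `Theorems/IsogenyCertificatesXMapPeriodTransfer{CellsBasic,Stub*}.lean`.

References: M. Kontsevich, D. Zagier, *Periods* (2001), §1.2; J. H. Silverman, *The Arithmetic of
Elliptic Curves* (2009), III.4–III.6; J. W. S. Cassels, *Lectures on Elliptic Curves* (1991), §15;
S. Basu, R. Pollack, M.-F. Roy, *Algorithms in Real Algebraic Geometry* (2006), Thm. 5.22.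
-/

noncomputable section

open Set Filter MeasureTheory Polynomial Topology
open Literature.NumberTheory.Transcendental
open Literature.ModelTheory.ExponentialFields (IsSemialgebraic)
open Summit.KontsevichZagierPeriods.KontsevichZagierPeriods.Theses.IsogenyCertificates (XMapPeriodTransfer)

namespace Summit.KontsevichZagierPeriods.IsogenyCertificates.XMapPeriodTransferCells

/-! ### The transfer for a coprime datum -/

/-- **The crux for a COPRIME datum.** -/
theorem transfer_of_coprime (A B A' B' : ℤ) (hΔ' : 4 * A' ^ 3 + 27 * B' ^ 2 ≠ 0) (f g : ℚ[X]) (c : ℚ)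
    (hcop : IsCoprime f g) (hW : derivative f * g - f * derivative g ≠ 0)
    (hI : C (c ^ 2) * g * (f ^ 3 + C (A' : ℚ) * f * g ^ 2 + C (B' : ℚ) * g ^ 3) =
      (X ^ 3 + C (A : ℚ) * X + C (B : ℚ)) * (derivative f * g - f * derivative g) ^ 2)
    (a b : ℚ) (hb : 0 < b) (r r' : KZ.IntegralRep 1)
    (h1 : r.domain = {x | 0 < x 0 ^ 3 + (A : ℝ) * x 0 + (B : ℝ)})
    (h2 : EqOn r.integrand (fun x => (a : ℝ) / Real.sqrt (x 0 ^ 3 + (A : ℝ) * x 0 + (B : ℝ))) r.domain)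
    (h3 : r'.domain = {x | 0 < x 0 ^ 3 + (A' : ℝ) * x 0 + (B' : ℝ)})
    (h4 : EqOn r'.integrand (fun x => (b : ℝ) / Real.sqrt (x 0 ^ 3 + (A' : ℝ) * x 0 + (B' : ℝ)))
      r'.domain)
    (h5 : r.value = r'.value) : KZ.Equivalent r r' := by
  obtain ⟨-, hsaS, -, hsaU, hsaE, -, -⟩ := stub_cellsBasic
  -- integrability of `dx/√P'` on `{P' > 0}`, inherited from `r'`
  have hintP' : IntegrableOn (fun x : Fin 1 → ℝ => 1 / Real.sqrt (x 0 ^ 3 + (A' : ℝ) * x 0 + (B' : ℝ)))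
      {x : Fin 1 → ℝ | 0 < x 0 ^ 3 + (A' : ℝ) * x 0 + (B' : ℝ)} :=
    XMapPeriodTransferValue.integrableOn_of_rep r' h3 h4 hb.ne'
  -- names for the objects of the line
  set S' : Set ℝ := {y : ℝ | 0 < y ^ 3 + (A' : ℝ) * y + (B' : ℝ)} with hS'
  set U' : Set ℝ := connectedComponentIn S' (1 + |(A' : ℝ)| + |(B' : ℝ)|) with hU'
  set E' : Set ℝ := S' \ U' with hE'
  set R : ℝ → ℝ := fun y => aeval y f / aeval y g with hR
  set W : ℝ → ℝ := fun y => aeval y (derivative f * g - f * derivative g) with hWd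
  set L : Set ℝ := {y : ℝ | 0 < y ^ 3 + (A : ℝ) * y + (B : ℝ) ∧
    aeval y (derivative f * g - f * derivative g) ≠ 0} with hL
  have hL' : L = {y : ℝ | 0 < y ^ 3 + (A : ℝ) * y + (B : ℝ) ∧ W y ≠ 0} := by rw [hL]
  -- the duplication datum on the target
  set f₂ : ℚ[X] := X ^ 4 - C (2 * (A' : ℚ)) * X ^ 2 - C (8 * (B' : ℚ)) * X + C ((A' : ℚ) ^ 2) with hf₂
  set g₂ : ℚ[X] := C 4 * (X ^ 3 + C (A' : ℚ) * X + C (B' : ℚ)) with hg₂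
  obtain ⟨hW₂, hI₂, -, -⟩ := stub_dupDatum A' B' f₂ g₂ hf₂ hg₂
  set R₂ : ℝ → ℝ := fun y => aeval y f₂ / aeval y g₂ with hR₂
  set W₂ : ℝ → ℝ := fun y => aeval y (derivative f₂ * g₂ - f₂ * derivative g₂) with hW₂d
  set L₂ : Set ℝ := {y : ℝ | 0 < y ^ 3 + (A' : ℝ) * y + (B' : ℝ) ∧
    aeval y (derivative f₂ * g₂ - f₂ * derivative g₂) ≠ 0} with hL₂
  have hL₂' : L₂ = {y : ℝ | 0 < y ^ 3 + (A' : ℝ) * y + (B' : ℝ) ∧ W₂ y ≠ 0} := by rw [hL₂]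
  have hU'S : U' ⊆ S' := connectedComponentIn_subset _ _
  have hE'S : E' ⊆ S' := Set.sdiff_subset
  have hUS : {x : Fin 1 → ℝ | x 0 ∈ U'} ⊆ {x : Fin 1 → ℝ | 0 < x 0 ^ 3 + (A' : ℝ) * x 0 + (B' : ℝ)} :=
    fun x hx => hU'S hx
  have hES : {x : Fin 1 → ℝ | x 0 ∈ E'} ⊆ {x : Fin 1 → ℝ | 0 < x 0 ^ 3 + (A' : ℝ) * x 0 + (B' : ℝ)} :=
    fun x hx => hE'S hx
  -- CENSUS 1: the datum on the whole of `{P > 0}`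
  obtain ⟨mU, mE, -, hcens⟩ := stub_cellCensus A B A' B' f g c hW hI R W L hR hWd hL' U' E' hU' hE'
    {y : ℝ | 0 < y ^ 3 + (A : ℝ) * y + (B : ℝ)} subset_rfl (hsaS A B)
    (fun x₀ _ _ => cell_subset_pos A B f g x₀)
    (fun x₀ hx₀ _ => by
      obtain ⟨hinj, himg⟩ := stub_cellImageComponent A B A' B' f g c hΔ' hW hI hcop R W L hR hWd hL'
        U' E' hU' hE' x₀ hx₀
      exact ⟨hinj, himg.imp id And.left⟩)
    (fun x₀ hx₀ _ => stub_cellMove A B A' B' f g c hW hI R W L hR hWd hL' x₀ hx₀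
      (stub_cellImageComponent A B A' B' f g c hΔ' hW hI hcop R W L hR hWd hL' U' E' hU' hE' x₀ hx₀).1)
    hintP'
  -- CENSUS 2 and 3: the duplication datum on `U'` and on `E'`
  have dup_census : ∀ (K : Set ℝ), K ⊆ S' → IsSemialgebraic ℚ {x : Fin 1 → ℝ | x 0 ∈ K} →
      (∀ x₀ ∈ L₂, x₀ ∈ K → connectedComponentIn L₂ x₀ ⊆ K) →
      ∃ k : ℕ, ∀ (s : ℚ) (ρ : KZ.IntegralRep 1), ρ.domain = {x | x 0 ∈ K} →
        EqOn ρ.integrand (fun x => (s : ℝ) / Real.sqrt (x 0 ^ 3 + (A' : ℝ) * x 0 + (B' : ℝ))) ρ.domain →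
        ∃ u : KZ.IntegralRep 1, u.domain = {x | x 0 ∈ U'} ∧
          EqOn u.integrand
            (fun x => ((k * s / |(2 : ℚ)| : ℚ) : ℝ) / Real.sqrt (x 0 ^ 3 + (A' : ℝ) * x 0 + (B' : ℝ)))
            u.domain ∧
          KZ.of ρ - KZ.of u ∈ KZ.relations := by
    intro K hK hKsa hKsat
    obtain ⟨kU, kE, hkE, hc⟩ := stub_cellCensus A' B' A' B' f₂ g₂ 2 hW₂ hI₂ R₂ W₂ L₂ hR₂ hW₂d hL₂'
      U' E' hU' hE' K hK hKsa hKsat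
      (fun x₀ hx₀ _ => by
        obtain ⟨hinj, himg⟩ := dup_cell_image A' B' hΔ' f₂ g₂ hf₂ hg₂ hx₀
        exact ⟨hinj, Or.inl himg⟩)
      (fun x₀ hx₀ _ => stub_cellMove A' B' A' B' f₂ g₂ 2 hW₂ hI₂ R₂ W₂ L₂ hR₂ hW₂d hL₂' x₀ hx₀
        (dup_cell_image A' B' hΔ' f₂ g₂ hf₂ hg₂ hx₀).1)
      hintP'
    have hkE0 : kE = 0 := hkE fun x₀ hx₀ _ => (dup_cell_image A' B' hΔ' f₂ g₂ hf₂ hg₂ hx₀).2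
    refine ⟨kU, fun s ρ hρd hρe => ?_⟩
    obtain ⟨u, e, hud, hue, hed, hee, hrel⟩ := hc s ρ hρd hρe
    have he0 : KZ.of e ∈ KZ.relations := by
      refine KZ.of_mem_relations_of_eqOn_zero e fun x hx => ?_
      rw [hee hx, hkE0]
      simp
    refine ⟨u, hud, hue, ?_⟩
    have : KZ.of ρ - KZ.of u = (KZ.of ρ - KZ.of u - KZ.of e) + KZ.of e := by abel
    rw [this]
    exact KZ.relations.add_mem hrel he0
  obtain ⟨kU, hcU⟩ := dup_census U' hU'S (hsaU A' B')
    (fun x₀ hx₀ hK => cell_subset_unbounded A' B' f₂ g₂ hx₀ hK)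
  obtain ⟨kE, hcE⟩ := dup_census E' hE'S (hsaE A' B')
    (fun x₀ hx₀ hK => cell_subset_egg A' B' f₂ g₂ hx₀ hK)
  -- push `[r]` to `U'`
  obtain ⟨u, e, hud, hue, hed, hee, hrel⟩ := hcens a r h1 h2
  obtain ⟨u₁, hu₁d, hu₁e, hrel₁⟩ := hcU (mU * a / |c|) u hud hue
  obtain ⟨u₂, hu₂d, hu₂e, hrel₂⟩ := hcE (mE * a / |c|) e hed hee
  -- push `[r']` to `U'`
  have hUsub : {x : Fin 1 → ℝ | x 0 ∈ U'} ⊆ r'.domain := by rw [h3]; exact hUS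
  have hEsub : {x : Fin 1 → ℝ | x 0 ∈ E'} ⊆ r'.domain := by rw [h3]; exact hES
  set r'U : KZ.IntegralRep 1 := r'.restrict _ (hsaU A' B') hUsub with hr'U
  set r'E : KZ.IntegralRep 1 := r'.restrict _ (hsaE A' B') hEsub with hr'E
  have hsplit : KZ.of r' - KZ.of r'U - KZ.of r'E ∈ KZ.relations := by
    refine KZ.domainAddRel_subset_relations ⟨1, r', r'U, r'E, ?_, ?_, fun _ _ => rfl, fun _ _ => rfl, rfl⟩
    · rw [KZ.IntegralRep.domain_restrict, KZ.IntegralRep.domain_restrict, h3]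
      ext x
      have hx : x ∈ ({x | x 0 ∈ U'} ∪ {x | x 0 ∈ E'} : Set (Fin 1 → ℝ)) ↔ x 0 ∈ U' ∪ E' := by
        simp only [mem_union, mem_setOf_eq]
      rw [hx, hE', Set.union_sdiff_cancel hU'S]
      rfl
    · have he : r'U.domain ∩ r'E.domain = ∅ := by
        rw [KZ.IntegralRep.domain_restrict, KZ.IntegralRep.domain_restrict]
        ext x
        simp only [mem_inter_iff, mem_setOf_eq, mem_empty_iff_false, iff_false, not_and]
        exact fun hU hE => hE.2 hU
      rw [he, measure_empty]
  obtain ⟨u₃, hu₃d, hu₃e, hrel₃⟩ := hcU b r'U (by rw [hr'U, KZ.IntegralRep.domain_restrict])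
    (fun x hx => h4 (hUsub hx))
  obtain ⟨u₄, hu₄d, hu₄e, hrel₄⟩ := hcE b r'E (by rw [hr'E, KZ.IntegralRep.domain_restrict])
    (fun x hx => h4 (hEsub hx))
  -- merge on `U'`
  set γ : ℚ := kU * (mU * a / |c|) / |(2 : ℚ)| + kE * (mE * a / |c|) / |(2 : ℚ)| with hγ
  set γ' : ℚ := kU * b / |(2 : ℚ)| + kE * b / |(2 : ℚ)| with hγ'
  obtain ⟨V, hVd, hVi⟩ := exists_rep A' B' γ (hsaU A' B') hUS hintP'
  obtain ⟨V', hV'd, hV'i⟩ := exists_rep A' B' γ' (hsaU A' B') hUS hintP'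
  have hmerge : KZ.of V - KZ.of u₁ - KZ.of u₂ ∈ KZ.relations := by
    refine KZ.integrandAddRel_subset_relations ⟨1, V, u₁, u₂, hu₁d.trans hVd.symm, hu₂d.trans hVd.symm,
      fun x hx => ?_, rfl⟩
    rw [Pi.add_apply, hVi, hu₁e (hu₁d.symm ▸ hVd ▸ hx), hu₂e (hu₂d.symm ▸ hVd ▸ hx), hγ]
    push_cast
    ring
  have hmerge' : KZ.of V' - KZ.of u₃ - KZ.of u₄ ∈ KZ.relations := by
    refine KZ.integrandAddRel_subset_relations ⟨1, V', u₃, u₄, hu₃d.trans hV'd.symm, hu₄d.trans hV'd.symm,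
      fun x hx => ?_, rfl⟩
    rw [Pi.add_apply, hV'i, hu₃e (hu₃d.symm ▸ hV'd ▸ hx), hu₄e (hu₄d.symm ▸ hV'd ▸ hx), hγ']
    push_cast
    ring
  -- `[r] ≡ [V]` and `[r'] ≡ [V']`
  have hrV : KZ.Equivalent r V := by
    have : KZ.of r - KZ.of V = (KZ.of r - KZ.of u - KZ.of e) + (KZ.of u - KZ.of u₁) +
        (KZ.of e - KZ.of u₂) - (KZ.of V - KZ.of u₁ - KZ.of u₂) := by abel
    show KZ.of r - KZ.of V ∈ KZ.relations
    rw [this]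
    exact KZ.relations.sub_mem (KZ.relations.add_mem (KZ.relations.add_mem hrel hrel₁) hrel₂) hmerge
  have hr'V' : KZ.Equivalent r' V' := by
    have : KZ.of r' - KZ.of V' = (KZ.of r' - KZ.of r'U - KZ.of r'E) + (KZ.of r'U - KZ.of u₃) +
        (KZ.of r'E - KZ.of u₄) - (KZ.of V' - KZ.of u₃ - KZ.of u₄) := by abel
    show KZ.of r' - KZ.of V' ∈ KZ.relations
    rw [this]
    exact KZ.relations.sub_mem (KZ.relations.add_mem (KZ.relations.add_mem hsplit hrel₃) hrel₄) hmerge'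
  -- the unique use of `r.value = r'.value`: the two scalars on `U'` agree
  have hΩ := unbounded_period_pos A' B' hintP'
  have hvV := value_rep (A := A') (B := B') V hVd (by rw [hVi]; exact fun _ _ => rfl)
  have hvV' := value_rep (A := A') (B := B') V' hV'd (by rw [hV'i]; exact fun _ _ => rfl)
  have hγγ' : (γ : ℝ) = γ' := by
    have e1 : V.value = V'.value := by
      rw [← KZ.Equivalent.value_eq_holds hrV, ← KZ.Equivalent.value_eq_holds hr'V', h5]
    rw [hvV, hvV'] at e1
    exact mul_right_cancel₀ hΩ.ne' e1
  have hVV' : KZ.Equivalent V V' :=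
    XMapPeriodTransferValue.equivalent_of_eqOn V V' (hV'd.trans hVd.symm) fun x _ => by
      rw [hVi, hV'i]
      simp only [hγγ']
  exact (hrV.trans hVV').trans hr'V'.symm

/-- **The crux `XMapPeriodTransfer`**, by name, from the registered stubs: reduce to coprime data
(`XMapPeriodTransferDatum.iff_coprime`) and apply `transfer_of_coprime`. -/
theorem XMapPeriodTransfer_of : XMapPeriodTransfer := by
  rw [XMapPeriodTransferDatum.iff_coprime]
  rintro A B A' B' - hΔ' ⟨f, g, c, hcop, hW, hI⟩ a b - hb r r' h1 h2 h3 h4 h5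
  exact transfer_of_coprime A B A' B' hΔ' f g c hcop hW hI a b hb r r' h1 h2 h3 h4 h5

end Summit.KontsevichZagierPeriods.IsogenyCertificates.XMapPeriodTransferCells

end
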